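import Mathlib.Algebra.Order.Ring.Abs
import Mathlib.Data.Int.ModEq
import Mathlib.Data.Int.Interval
import Mathlib.Combinatorics.Pigeonhole
import Mathlib.Tactic
import Literature.MathematicalPhysics.StatisticalMechanics.BarlowStacking
import Summits.AtomisticToContinuum.Crystallization.Theorems.GscTwinLoopSurgeryGscHingeGlueBarlow

/-!
# The Shockley block flip at the Hägg-chain level (stub `stub_chainBlockFlip` of `StackingFaultSparsity`)

Support of item `stmt-AtomisticToContinuum-14296` (`StackingFaultSparsity`, routes `SquareWellLayerCake` /
`LaminarSixThreeThree`), line `Sketch`: the EXACT-LATTICE one-dimensional core of the restacking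
competitor behind the physics stub `stub_diluteFaults` (card `Ideas/shockley-slab-restacking.md`).
A Hägg word `s : ℤ → {±1}` codes a Barlow stacking; letter `m` is CUBIC when `s (m+1) = s m`. The
*block flip* of `[q₁, q₂)` negates the letters on the block (`s' n = if q₁ ≤ n ∧ n < q₂ then -s n
else s n`; a legitimate restacking iff the block has zero registry charge
`3 ∣ haggLabel s q₂ - haggLabel s q₁`). Proved: `exists_zero_charge_block` (ℤ/3 pigeonhole among four
layers), `blockFlip_cubic_iff` (cubic ends ⇒ exactly the two end letters turn hexagonal, none is
created), `blockFlip_localEnergyTrunc_eq` (range-`K` local energies `haggLocalEnergyTrunc` unchanged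
off `[q₁ - K, q₂)`), `blockFlip_energyTrunc_le` (total range-`K` change
`≤ 2 J₂ + 2 ∑_{k=3}^{K} (k-1)|J_k|`: alignment is flip-invariant unless the window straddles exactly
one cut — `haggAligned_flip_iff`; at distance `2` exactly the two end windows become aligned, at
distance `k ≥ 3` at most `k - 1` windows per cut change, each by `≤ |J_k|`). With Hägg domination
(stmt-AtomisticToContinuum-3063) the change is `≤ J₂ < 0`. `stub_chainBlockFlip` bundles the four
facts. Pure combinatorics of `±1` words; no physics, no numerics.
-/

noncomputable section

namespace Summit.AtomisticToContinuum.Crystallization.Theorems.SquareWellLayerCake.StackingFaultSparsity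

open Literature.MathematicalPhysics.StatisticalMechanics
open Summit.AtomisticToContinuum.Crystallization.Theorems.GscHingeGlue (haggWindow_congr)

/-! ## The ℤ/3 pigeonhole -/

/-- Among four integers two are congruent mod `3`, with the smaller index first. -/
theorem exists_lt_modEq_three (L : Fin 4 → ℤ) :
    ∃ i j : Fin 4, i < j ∧ L i ≡ L j [ZMOD 3] := by
  have hcard : Fintype.card (Fin 3) < Fintype.card (Fin 4) := by simp
  let r : Fin 4 → Fin 3 := fun i => ⟨(L i % 3).toNat, by
    have h0 : 0 ≤ L i % 3 := Int.emod_nonneg _ (by norm_num)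
    have h3 : L i % 3 < 3 := Int.emod_lt_of_pos _ (by norm_num)
    omega⟩
  obtain ⟨i, j, hne, hr⟩ := Fintype.exists_ne_map_eq_of_card_lt r hcard
  have hmod : L i ≡ L j [ZMOD 3] := by
    have h := congrArg Fin.val hr
    simp only [r] at h
    have h0i : 0 ≤ L i % 3 := Int.emod_nonneg _ (by norm_num)
    have h0j : 0 ≤ L j % 3 := Int.emod_nonneg _ (by norm_num)
    exact (show L i % 3 = L j % 3 by omega)
  rcases lt_or_gt_of_ne hne with h | h
  exacts [⟨i, j, h, hmod⟩, ⟨j, i, h, hmod.symm⟩]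

/-- **Zero-charge block**: for a strictly increasing quadruple of layers, two of them bound a block
whose registry charge `haggLabel s (q j) - haggLabel s (q i)` is divisible by `3`. -/
theorem exists_zero_charge_block (s : ℤ → ℤ) (q : Fin 4 → ℤ) (hq : StrictMono q) :
    ∃ i j : Fin 4, q i < q j ∧ (3 : ℤ) ∣ haggLabel s (q j) - haggLabel s (q i) := by
  obtain ⟨i, j, hij, hmod⟩ := exists_lt_modEq_three (fun i => haggLabel s (q i))
  exact ⟨i, j, hq hij, (Int.modEq_iff_dvd.1 hmod)⟩

/-! ## The block flip -/

/-- (i) the cubic letters after the block flip are the old ones minus the two ends. -/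
theorem blockFlip_cubic_iff :
    ∀ (s : ℤ → ℤ) (q₁ q₂ : ℤ), IsHaggSeq s → q₁ < q₂ → s q₁ = s (q₁ - 1) → s q₂ = s (q₂ - 1) →
      ∀ m : ℤ,
        ((fun n : ℤ => if q₁ ≤ n ∧ n < q₂ then -s n else s n) (m + 1) =
            (fun n : ℤ => if q₁ ≤ n ∧ n < q₂ then -s n else s n) m) ↔
          (s (m + 1) = s m ∧ m ≠ q₁ - 1 ∧ m ≠ q₂ - 1) := by
  intro s q₁ q₂ hs hq hc₁ hc₂ m
  have hq1 := hs q₁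
  simp only
  by_cases hm : q₁ ≤ m ∧ m < q₂ <;> by_cases hm1 : q₁ ≤ m + 1 ∧ m + 1 < q₂
  · -- both inside
    rw [if_pos hm1, if_pos hm]
    constructor
    · intro h; refine ⟨by linarith, ?_, ?_⟩ <;> omega
    · rintro ⟨h, -, -⟩; linarith
  · -- m inside, m+1 outside: m = q₂ - 1
    rw [if_neg hm1, if_pos hm]
    have hm' : m = q₂ - 1 := by omega
    subst hm'
    simp only [sub_add_cancel] at *
    constructor
    · intro h
      exfalso
      rw [hc₂] at h
      rcases hs (q₂ - 1) with h' | h' <;> rw [h'] at h <;> norm_num at h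
    · rintro ⟨-, -, h⟩; exact absurd rfl h
  · -- m outside, m+1 inside: m = q₁ - 1
    rw [if_pos hm1, if_neg hm]
    have hm'' : m = q₁ - 1 := by omega
    subst hm''
    simp only [sub_add_cancel] at *
    constructor
    · intro h
      exfalso
      rw [← hc₁] at h
      rcases hq1 with h' | h' <;> rw [h'] at h <;> norm_num at h
    · rintro ⟨-, h, -⟩; exact absurd rfl h
  · -- both outside
    rw [if_neg hm1, if_neg hm]
    constructor
    · intro h; refine ⟨h, ?_, ?_⟩ <;> omega
    · rintro ⟨h, -, -⟩; exact h

/-- (ii, finite form) outside `[q₁ - K, q₂)` the range-`K` local energies do not change. -/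
theorem blockFlip_localEnergyTrunc_eq :
    ∀ (K : ℕ) (J : ℕ → ℝ) (s : ℤ → ℤ) (q₁ q₂ m : ℤ), (m + K < q₁ ∨ q₂ ≤ m) →
      haggLocalEnergyTrunc K J (fun n : ℤ => if q₁ ≤ n ∧ n < q₂ then -s n else s n) m =
        haggLocalEnergyTrunc K J s m := by
  intro K J s q₁ q₂ m hm
  unfold haggLocalEnergyTrunc
  refine Finset.sum_congr rfl fun k hk => ?_
  rw [Finset.mem_Icc] at hk
  have hw : haggWindow (fun n : ℤ => if q₁ ≤ n ∧ n < q₂ then -s n else s n) m k = haggWindow s m k := by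
    unfold haggWindow
    refine Finset.sum_congr rfl fun i hi => ?_
    rw [Finset.mem_range] at hi
    have hnot : ¬ (q₁ ≤ m + i ∧ m + i < q₂) := by
      rcases hm with hm | hm
      · intro ⟨h1, _⟩
        have : (i : ℤ) < k := by exact_mod_cast hi
        have : (k : ℤ) ≤ K := by exact_mod_cast hk.2
        omega
      · intro ⟨_, h2⟩
        have : (0 : ℤ) ≤ i := by exact_mod_cast Nat.zero_le i
        omega
    simp only [hnot, if_false]
  simp only [HaggAligned, hw]

/-! ### Helpers for the energy bound -/

/-- Additivity of window sums. -/
theorem haggWindow_add' (s : ℤ → ℤ) (m : ℤ) (j l : ℕ) :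
    haggWindow s m (j + l) = haggWindow s m j + haggWindow s (m + j) l := by
  induction l with
  | zero => simp
  | succ l ih => rw [← add_assoc, haggWindow_succ, ih, haggWindow_succ]; push_cast; ring_nf

/-- Windows over negated letters are negated. -/
theorem haggWindow_neg_of {s s' : ℤ → ℤ} {m : ℤ} {k : ℕ}
    (h : ∀ i : ℕ, i < k → s' (m + i) = -s (m + i)) : haggWindow s' m k = -haggWindow s m k := by
  unfold haggWindow
  rw [← Finset.sum_neg_distrib]
  exact Finset.sum_congr rfl fun i hi => h i (Finset.mem_range.1 hi)

/-- **Alignment is flip-invariant off the straddling pairs.**  If the window `[m, m+k)` does not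
straddle exactly one cut of the block `[q₁, q₂)` (i.e. it avoids the block, lies inside it, or
contains it — the last case uses the zero charge), the flipped word is aligned on it iff the
original word is. -/
theorem haggAligned_flip_iff {s s' : ℤ → ℤ} {q₁ q₂ : ℤ} (hq : q₁ < q₂)
    (hs' : ∀ n, s' n = if q₁ ≤ n ∧ n < q₂ then -s n else s n)
    (hcharge : (3 : ℤ) ∣ haggLabel s q₂ - haggLabel s q₁) (m : ℤ) (k : ℕ)
    (hns : ¬ ((m < q₁ ∧ q₁ < m + k ∧ m + k ≤ q₂) ∨ (q₁ ≤ m ∧ m < q₂ ∧ q₂ < m + k))) :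
    HaggAligned s' m k ↔ HaggAligned s m k := by
  simp only [HaggAligned]
  by_cases h1 : m + k ≤ q₁ ∨ q₂ ≤ m
  · -- the window avoids the block
    rw [haggWindow_congr]
    intro i hi
    rw [hs']
    have : ¬ (q₁ ≤ m + i ∧ m + i < q₂) := by
      intro ⟨ha, hb⟩
      have : (i : ℤ) < k := by exact_mod_cast hi
      have : (0 : ℤ) ≤ i := by exact_mod_cast Nat.zero_le i
      omega
    rw [if_neg this]
  push Not at h1
  obtain ⟨h1a, h1b⟩ := h1
  by_cases h2 : q₁ ≤ m
  · -- m inside the block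
    by_cases h3 : m + k ≤ q₂
    · -- the window lies inside the block: window' = -window
      rw [haggWindow_neg_of]
      · constructor
        · intro h
          have : (3 : ℤ) ∣ -haggWindow s m k := Int.dvd_of_emod_eq_zero h
          exact Int.emod_eq_zero_of_dvd (Int.dvd_neg.1 this)
        · intro h
          have : (3 : ℤ) ∣ haggWindow s m k := Int.dvd_of_emod_eq_zero h
          exact Int.emod_eq_zero_of_dvd (Int.dvd_neg.2 this)
      · intro i hi
        rw [hs']
        have : q₁ ≤ m + i ∧ m + i < q₂ := by
          have : (i : ℤ) < k := by exact_mod_cast hi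
          have : (0 : ℤ) ≤ i := by exact_mod_cast Nat.zero_le i
          constructor <;> omega
        rw [if_pos this]
    · exfalso; apply hns; right; exact ⟨h2, h1b, by omega⟩
  · push Not at h2
    by_cases h3 : m + k ≤ q₂
    · exfalso; apply hns; left; exact ⟨h2, h1a, h3⟩
    · -- the window contains the block: decompose k = j + l + r
      push Not at h3
      obtain ⟨j, hj⟩ : ∃ j : ℕ, (j : ℤ) = q₁ - m := ⟨(q₁ - m).toNat, by omega⟩
      obtain ⟨l, hl⟩ : ∃ l : ℕ, (l : ℤ) = q₂ - q₁ := ⟨(q₂ - q₁).toNat, by omega⟩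
      obtain ⟨r, hr⟩ : ∃ r : ℕ, (r : ℤ) = m + k - q₂ := ⟨(m + k - q₂).toNat, by omega⟩
      have hk : k = (j + l) + r := by
        have : (k : ℤ) = j + l + r := by omega
        exact_mod_cast this
      have hmj : m + (j : ℤ) = q₁ := by omega
      have hmjl : m + ((j + l : ℕ) : ℤ) = q₂ := by push_cast; omega
      have hW : ∀ t : ℤ → ℤ, haggWindow t m k =
          haggWindow t m j + haggWindow t q₁ l + haggWindow t q₂ r := by
        intro t
        rw [hk, haggWindow_add', haggWindow_add', hmj, hmjl]
      have hj_eq : haggWindow s' m j = haggWindow s m j := by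
        apply haggWindow_congr
        intro i hi
        rw [hs']
        have : ¬ (q₁ ≤ m + i ∧ m + i < q₂) := by
          intro ⟨ha, hb⟩
          have : (i : ℤ) < j := by exact_mod_cast hi
          omega
        rw [if_neg this]
      have hl_eq : haggWindow s' q₁ l = -haggWindow s q₁ l := by
        apply haggWindow_neg_of
        intro i hi
        rw [hs']
        have : q₁ ≤ q₁ + i ∧ q₁ + i < q₂ := by
          have : (i : ℤ) < l := by exact_mod_cast hi
          have : (0 : ℤ) ≤ i := by exact_mod_cast Nat.zero_le i
          constructor <;> omega
        rw [if_pos this]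
      have hr_eq : haggWindow s' q₂ r = haggWindow s q₂ r := by
        apply haggWindow_congr
        intro i hi
        rw [hs']
        have : ¬ (q₁ ≤ q₂ + i ∧ q₂ + i < q₂) := by
          intro ⟨ha, hb⟩
          have : (0 : ℤ) ≤ i := by exact_mod_cast Nat.zero_le i
          omega
        rw [if_neg this]
      have hlab : haggWindow s q₁ l = haggLabel s q₂ - haggLabel s q₁ := by
        have := haggLabel_add_natCast s q₁ l
        have hq2 : q₁ + (l : ℤ) = q₂ := by omega
        rw [hq2] at this
        linarith
      have hmod : haggWindow s' m k ≡ haggWindow s m k [ZMOD 3] := by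
        rw [Int.modEq_iff_dvd, hW s', hW s, hj_eq, hl_eq, hr_eq]
        have : haggWindow s m j + haggWindow s q₁ l + haggWindow s q₂ r -
            (haggWindow s m j + -haggWindow s q₁ l + haggWindow s q₂ r) =
            2 * (haggLabel s q₂ - haggLabel s q₁) := by rw [← hlab]; ring
        rw [this]
        exact Dvd.dvd.mul_left hcharge 2
      exact ⟨fun h => hmod ▸ h, fun h => hmod.symm ▸ h⟩

/-- (iii, finite form) the range-`K` chain-energy change of the block flip is at most
`2 J₂ + 2 ∑_{k=3}^{K} (k-1)|J_k|`. -/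
theorem blockFlip_energyTrunc_le :
    ∀ (K : ℕ) (J : ℕ → ℝ) (s : ℤ → ℤ) (q₁ q₂ : ℤ), IsHaggSeq s → q₁ < q₂ →
      (3 : ℤ) ∣ haggLabel s q₂ - haggLabel s q₁ → s q₁ = s (q₁ - 1) → s q₂ = s (q₂ - 1) → 2 ≤ K →
      ∑ m ∈ Finset.Icc (q₁ - K) q₂,
          (haggLocalEnergyTrunc K J (fun n : ℤ => if q₁ ≤ n ∧ n < q₂ then -s n else s n) m -
            haggLocalEnergyTrunc K J s m) ≤
        2 * J 2 + 2 * ∑ k ∈ Finset.Icc 3 K, ((k : ℝ) - 1) * |J k| := by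
  intro K J s q₁ q₂ hs hq hcharge hc₁ hc₂ hK
  set s' : ℤ → ℤ := fun n => if q₁ ≤ n ∧ n < q₂ then -s n else s n with hs'def
  have hs' : ∀ n, s' n = if q₁ ≤ n ∧ n < q₂ then -s n else s n := fun n => rfl
  have hq2 : q₁ + 2 ≤ q₂ := by
    by_contra hlt
    have heq : q₂ = q₁ + 1 := by omega
    have : haggLabel s q₂ - haggLabel s q₁ = s q₁ := by rw [heq, haggLabel_succ]; ring
    rw [this] at hcharge
    rcases hs q₁ with h | h <;> rw [h] at hcharge <;> omega
  set d : ℤ → ℕ → ℝ := fun m k =>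
    (if HaggAligned s' m k then J k else 0) - (if HaggAligned s m k then J k else 0) with hd
  have hsum : ∀ m, haggLocalEnergyTrunc K J s' m - haggLocalEnergyTrunc K J s m =
      ∑ k ∈ Finset.Icc 2 K, d m k := by
    intro m
    simp only [haggLocalEnergyTrunc, hd, Finset.sum_sub_distrib]
  rw [Finset.sum_congr rfl fun m _ => hsum m, Finset.sum_comm]
  have hd_abs : ∀ m k, |d m k| ≤ |J k| := by
    intro m k; simp only [hd]; split_ifs <;> simp
  have hd_zero : ∀ (m : ℤ) (k : ℕ),
      ¬ ((m < q₁ ∧ q₁ < m + k ∧ m + k ≤ q₂) ∨ (q₁ ≤ m ∧ m < q₂ ∧ q₂ < m + k)) → d m k = 0 := by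
    intro m k hns
    have hiff := haggAligned_flip_iff hq hs' hcharge m k hns
    by_cases hA : HaggAligned s m k
    · simp only [hd, if_pos (hiff.2 hA), if_pos hA, sub_self]
    · simp only [hd, if_neg (fun h => hA (hiff.1 h)), if_neg hA, sub_self]
  have hd2 : ∀ m : ℤ, d m 2 = (if m = q₁ - 1 then J 2 else 0) + (if m = q₂ - 1 then J 2 else 0) := by
    intro m
    by_cases hm1 : m = q₁ - 1
    · subst hm1
      have hne : ¬ (q₁ - 1 = q₂ - 1) := by omega
      rw [if_pos rfl, if_neg hne, add_zero]
      simp only [hd]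
      have hA' : HaggAligned s' (q₁ - 1) 2 := by
        simp only [HaggAligned, haggWindow, Finset.sum_range_succ, Finset.sum_range_zero,
          zero_add, Nat.cast_zero, add_zero, Nat.cast_one, sub_add_cancel, hs']
        rw [if_neg (by omega), if_pos ⟨le_rfl, hq⟩, hc₁]
        simp
      have hA : ¬ HaggAligned s (q₁ - 1) 2 := by
        simp only [HaggAligned, haggWindow, Finset.sum_range_succ, Finset.sum_range_zero, zero_add,
          Nat.cast_zero, add_zero, Nat.cast_one, sub_add_cancel, ← hc₁]
        rcases hs q₁ with h | h <;> rw [h] <;> decide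
      rw [if_pos hA', if_neg hA, sub_zero]
    · by_cases hm2 : m = q₂ - 1
      · subst hm2
        rw [if_neg hm1, if_pos rfl, zero_add]
        simp only [hd]
        have hA' : HaggAligned s' (q₂ - 1) 2 := by
          simp only [HaggAligned, haggWindow, Finset.sum_range_succ, Finset.sum_range_zero, zero_add,
            Nat.cast_zero, add_zero, Nat.cast_one, sub_add_cancel, hs']
          rw [if_pos ⟨by omega, by omega⟩, if_neg (by omega), hc₂]
          simp
        have hA : ¬ HaggAligned s (q₂ - 1) 2 := by
          simp only [HaggAligned, haggWindow, Finset.sum_range_succ, Finset.sum_range_zero, zero_add,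
            Nat.cast_zero, add_zero, Nat.cast_one, sub_add_cancel, ← hc₂]
          rcases hs q₂ with h | h <;> rw [h] <;> decide
        rw [if_pos hA', if_neg hA, sub_zero]
      · rw [if_neg hm1, if_neg hm2, add_zero]
        apply hd_zero
        push_cast
        omega
  have hT2 : ∑ m ∈ Finset.Icc (q₁ - K) q₂, d m 2 = 2 * J 2 := by
    rw [Finset.sum_congr rfl fun m _ => hd2 m, Finset.sum_add_distrib, Finset.sum_ite_eq',
      Finset.sum_ite_eq']
    have h1 : q₁ - 1 ∈ Finset.Icc (q₁ - K) q₂ := by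
      rw [Finset.mem_Icc]; constructor <;> omega
    have h2 : q₂ - 1 ∈ Finset.Icc (q₁ - K) q₂ := by
      rw [Finset.mem_Icc]; constructor <;> omega
    rw [if_pos h1, if_pos h2]; ring
  have hTk : ∀ k ∈ Finset.Icc 3 K, ∑ m ∈ Finset.Icc (q₁ - K) q₂, d m k ≤ 2 * (((k : ℝ) - 1) * |J k|) := by
    intro k hk
    rw [Finset.mem_Icc] at hk
    set W : Finset ℤ := Finset.Icc (q₁ - k + 1) (q₁ - 1) ∪ Finset.Icc (q₂ - k + 1) (q₂ - 1) with hW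
    have hWcard : (W.card : ℝ) ≤ 2 * ((k : ℝ) - 1) := by
      have h1 : (Finset.Icc (q₁ - k + 1) (q₁ - 1)).card = k - 1 := by rw [Int.card_Icc]; omega
      have h2 : (Finset.Icc (q₂ - k + 1) (q₂ - 1)).card = k - 1 := by rw [Int.card_Icc]; omega
      have hc : W.card ≤ (k - 1) + (k - 1) := by
        calc W.card ≤ _ := Finset.card_union_le _ _
          _ = (k - 1) + (k - 1) := by rw [h1, h2]
      have hk1 : 1 ≤ k := by omega
      have : (W.card : ℝ) ≤ ((k - 1 : ℕ) : ℝ) + ((k - 1 : ℕ) : ℝ) := by exact_mod_cast hc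
      rw [Nat.cast_sub hk1] at this
      push_cast at this
      linarith
    have hbound : ∀ m ∈ Finset.Icc (q₁ - K) q₂, d m k ≤ if m ∈ W then |J k| else 0 := by
      intro m _
      by_cases hmW : m ∈ W
      · rw [if_pos hmW]; exact (le_abs_self _).trans (hd_abs m k)
      · rw [if_neg hmW, hd_zero m k]
        intro hstr
        apply hmW
        rw [hW, Finset.mem_union, Finset.mem_Icc, Finset.mem_Icc]
        rcases hstr with ⟨h1, h2, h3⟩ | ⟨h1, h2, h3⟩
        · left; constructor <;> omega
        · right; constructor <;> omega
    calc ∑ m ∈ Finset.Icc (q₁ - K) q₂, d m k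
        ≤ ∑ m ∈ Finset.Icc (q₁ - K) q₂, (if m ∈ W then |J k| else 0) := Finset.sum_le_sum hbound
      _ = ((Finset.Icc (q₁ - K) q₂).filter (fun m => m ∈ W)).card * |J k| := by
          rw [Finset.sum_ite, Finset.sum_const, Finset.sum_const_zero, add_zero, nsmul_eq_mul]
      _ ≤ W.card * |J k| := by
          apply mul_le_mul_of_nonneg_right _ (abs_nonneg _)
          exact_mod_cast Finset.card_le_card (fun m hm => (Finset.mem_filter.1 hm).2)
      _ ≤ 2 * ((k : ℝ) - 1) * |J k| := mul_le_mul_of_nonneg_right hWcard (abs_nonneg _)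
      _ = 2 * (((k : ℝ) - 1) * |J k|) := by ring
  rw [← Finset.insert_Icc_add_one_left_eq_Icc hK, Finset.sum_insert (by simp), hT2, Finset.mul_sum]
  exact add_le_add le_rfl (Finset.sum_le_sum hTk)

/-! ## The registered stub -/

/-- **Stub `stub_chainBlockFlip` of line `Sketch` (crux `StackingFaultSparsity`,
stmt-AtomisticToContinuum-14296)**: the four exact-lattice Hägg-chain facts of the Shockley block
flip, bundled — (a) ℤ/3 pigeonhole for a zero-charge block among four layers, (b) the flip of a
block with cubic ends removes exactly the two end cubic letters, (c) range-`K` local energies are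
unchanged off `[q₁ - K, q₂)`, (d) the total range-`K` chain-energy change is
`≤ 2 J₂ + 2 ∑_{k=3}^{K} (k-1)|J_k|`. -/
theorem stub_chainBlockFlip :
    (∀ (s : ℤ → ℤ) (q : Fin 4 → ℤ), StrictMono q →
      ∃ i j : Fin 4, q i < q j ∧ (3 : ℤ) ∣ haggLabel s (q j) - haggLabel s (q i)) ∧
    (∀ (s : ℤ → ℤ) (q₁ q₂ : ℤ), IsHaggSeq s → q₁ < q₂ → s q₁ = s (q₁ - 1) → s q₂ = s (q₂ - 1) →
      ∀ m : ℤ,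
        ((fun n : ℤ => if q₁ ≤ n ∧ n < q₂ then -s n else s n) (m + 1) =
            (fun n : ℤ => if q₁ ≤ n ∧ n < q₂ then -s n else s n) m) ↔
          (s (m + 1) = s m ∧ m ≠ q₁ - 1 ∧ m ≠ q₂ - 1)) ∧
    (∀ (K : ℕ) (J : ℕ → ℝ) (s : ℤ → ℤ) (q₁ q₂ m : ℤ), (m + K < q₁ ∨ q₂ ≤ m) →
      haggLocalEnergyTrunc K J (fun n : ℤ => if q₁ ≤ n ∧ n < q₂ then -s n else s n) m =
        haggLocalEnergyTrunc K J s m) ∧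
    (∀ (K : ℕ) (J : ℕ → ℝ) (s : ℤ → ℤ) (q₁ q₂ : ℤ), IsHaggSeq s → q₁ < q₂ →
      (3 : ℤ) ∣ haggLabel s q₂ - haggLabel s q₁ → s q₁ = s (q₁ - 1) → s q₂ = s (q₂ - 1) → 2 ≤ K →
      ∑ m ∈ Finset.Icc (q₁ - K) q₂,
          (haggLocalEnergyTrunc K J (fun n : ℤ => if q₁ ≤ n ∧ n < q₂ then -s n else s n) m -
            haggLocalEnergyTrunc K J s m) ≤
        2 * J 2 + 2 * ∑ k ∈ Finset.Icc 3 K, ((k : ℝ) - 1) * |J k|) :=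
  ⟨exists_zero_charge_block, blockFlip_cubic_iff, blockFlip_localEnergyTrunc_eq, blockFlip_energyTrunc_le⟩

end Summit.AtomisticToContinuum.Crystallization.Theorems.SquareWellLayerCake.StackingFaultSparsity

end
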